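import Literature.NumberTheory.GaloisCohomology.RestrictedRamificationExtComparisonNaturality
import Literature.NumberTheory.GaloisCohomology.RestrictedRamificationExtTrivComparison
import Literature.NumberTheory.GaloisRepresentations.TateDualBidualityLevels
import Literature.NumberTheory.GaloisRepresentations.TateDualUnramified
import HarnessLib

/-!
# The comparison `cmp : Extʳ_{C_{G_S}}(⟨(M^D(n))^{N_S}⟩, ⟨Ē_S⟩) → Hʳ(G_S, M^{N_S})` of the `Ext` road
# (dual level `n`, Kummer level `d`), read through the mixed biduality `Hom(Hom(M, μₙ), μ_d) = M`,
# and its naturality for an ADJOINT PAIR `(F, G)`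

Topic `NumberTheory/GaloisCohomology`; namespace `Literature.NumberTheory.GaloisCohomology.RestrictedExtCmp`.
Definitions WITH BODIES (`bidualTransport`, `bidualCotransport`, `cmp`) and theorems; no named fact, no `sorry`, no instance, no
notation.  Lane «PT-Ш-S-TC» of cell `bsd-eis` (crux `GoodLatticeBDPValue`), brick D5c, sub-brick c3: the input
`cmp` / `hcmp` / `hcmpG` of `ShaExtRoad.pairing_perfect` / `ShaExtRoad.pairing_natural` for the module on the
`Ш²` side written as `M` ITSELF (the named fact pairs `Ш²_S(K, M)` with `Ш¹_S(K, M^D)`), with the presented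
object `A := ⟨(M^D)^{N_S}⟩` ("`A` is `M^D`").

THE MATHEMATICS.  TWO LEVELS: the named fact's admissibility is "`v ∣ #M ⇒ v ∈ S`" (not "`v ∣ n`"), so
Kummer theory on `Ē_S` runs at a level `d` with `d • M = 0` and `v ∣ d ⇒ v ∈ S` (e.g. `d = #M`), while the
dual `M^D(n)` keeps the fact's level `n`.  bsd-eis -w7 g12's
`RestrictedExt.extAddEquivRestrictedCohomologyTateDual K S d ρ₀ … r : Extʳ(⟨M₀^{N_S}⟩, ⟨Ē_S⟩) ≃+
Hʳ(G_S, (M₀^D(d))^{N_S})` (Harari Lemma 17.21 (a) / Milne I Lemma 4.12) at `ρ₀ := ρ.tateDual n` lands in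
`Hʳ(G_S, Hom(Hom(M, μₙ), μ_d)^{N_S})`; composing with `Hʳ(G_S, κ₂)` for the canonical inverse MIXED
BIDUALITY `κ₂ = bidualInv₂ : Hom(Hom(M, μₙ), μ_d) → M` (`TateDualBidualityLevels`, an isomorphism of
`Γ_K`-modules) gives **`cmp`** into `Hʳ(G_S, M^{N_S}) = restrictedCohomology ρ S r`, bijective
(`cmp_bijective`).  For two admissible
modules and an ADJOINT PAIR `F : M → M'`, `G : M'^D(n') → M^D(n)` (`(G φ')(m) = φ'(F m)` in `K̄ˣ`, the
hypothesis of clause (N) of `poitouTate_shaRestricted_tateDual_natural`), **`cmp_natural`**: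
`cmp' (G ∘ y) = Hʳ(G_S, F) (cmp y)` — -w7 g12's `extAddEquivRestrictedCohomologyTateDual_precomp` with
`φ := (F^{DD})^{N_S}`, `F^{DD} = ι₂' ∘ F ∘ κ₂` the double transpose (its adjointness to `G` is
`muVal_doubleTranspose₂_apply`), followed by the square `κ₂' ∘ F^{DD} = F ∘ κ₂` (`bidualInv₂_doubleTranspose₂`)
in `Hʳ(G_S, ·)` (N0 functoriality).  With `y = x ∘ [T]` this is exactly the hypothesis `hcmpG` of
`ShaExtRoad.pairing_natural` for `G := RestrictedExtTriv.quotientInvariantsMap … G` — the SAME morphism as in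
its `hnatG` (`RestrictedRamificationExtTrivComparison`).  Levels `n`, `n'` arbitrary (`≥ 1`, killing the
module); `M^D(n)` is unramified outside `S` by `isUnramifiedOutside_tateDual_of_nsmul_eq_zero` (`v ∣ d ⇒ v ∈ S`).

HONEST FRAMING: bookkeeping over -w7 g12's comparison; no case of Poitou–Tate duality and nothing about BSD is
proved here.  AI formalisation, weaker than expert review; established only by the kernel check.

## References
* D. Harari, *Galois Cohomology and Class Field Theory* (2020), Lemma 17.21 (a), §16.2 (16.4). [Harari2020]
* J. S. Milne, *Arithmetic Duality Theorems*, 2nd ed. (2006), I Lemma 4.12, I Thm. 4.10 (a) (proof p. 58, and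
  "canonical" p. 65), I §0 Prop. 0.19. [MilneADT2006]
-/

noncomputable section

open CategoryTheory CategoryTheory.Abelian NumberField IsDedekindDomain Function
open scoped NumberField ContRepresentation

namespace Literature.NumberTheory.GaloisCohomology

namespace RestrictedExtCmp

open Literature.Algebra.Homology Literature.Algebra.Homology.DiscreteRep
open Literature.NumberTheory.GaloisRepresentations
open Literature.NumberTheory.GaloisRepresentations.DiscreteGaloisModule

variable {K : Type} [Field K] [NumberField K] (S : Set (HeightOneSpectrum (𝓞 K)))
  {M : Type} [AddCommGroup M] [TopologicalSpace M] [DiscreteTopology M] [Finite M]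
  (ρ : DiscreteGaloisModule K M) (n d : ℕ) [NeZero n] [NeZero d] [Finite (TateDual K M n)]

/-! ## §1 `M^D(n)` is unramified outside `S ⊇ {v ∣ d}` when `d • M = 0` -/

omit [NeZero n] [Finite (TateDual K M n)] in
/-- `N_S ≤ ker (M^D(n))` when `N_S ≤ ker M`, `d • M = 0` and every `v ∣ d` lies in `S` (the `hur` input of the
comparison at `ρ₀ := ρ.tateDual n`). [cite: MilneADT2006, Ch. I §0 (the module `M^D`)] -/
theorem ramificationSubgroup_le_ker_tateDual (hd : ∀ m : M, d • m = 0)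
    (hdS : ∀ v : HeightOneSpectrum (𝓞 K), ((d : ℕ) : 𝓞 K) ∈ v.asIdeal → v ∈ S)
    (hur : ramificationSubgroup K S ≤ ContinuousRep.ker ρ) :
    ramificationSubgroup K S ≤ ContinuousRep.ker (ρ.tateDual n) :=
  (isUnramifiedOutside_iff_ramificationSubgroup_le_ker _ S).1
    (isUnramifiedOutside_tateDual_of_nsmul_eq_zero ρ (Nat.pos_of_ne_zero (NeZero.ne d)) hd hdS
      ((isUnramifiedOutside_iff_ramificationSubgroup_le_ker ρ S).2 hur) n)

/-! ## §2 Transport along the inverse biduality on `Hʳ(G_S, ·^{N_S})` -/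

/-- **`Hʳ(G_S, κ) : Hʳ(G_S, (M^{DD})^{N_S}) → Hʳ(G_S, M^{N_S})`** for the inverse biduality `κ = bidualInv`.
[cite: MilneADT2006, Ch. I §0 Prop. 0.19] -/
def bidualTransport (hd : ∀ m : M, d • m = 0) (hn : ∀ m : M, n • m = 0) (r : ℕ) :
    restrictedCohomology ((ρ.tateDual n).tateDual d) S r →+ restrictedCohomology ρ S r :=
  (ContinuousCohomology.map (ContinuousMonoidHom.id (GaloisGroupUnramifiedOutside K S))
    (ContinuousRep.invariantsHom (N := ramificationSubgroup K S)
      (TopRep.ofHom (bidualInv₂ ρ n d hd hn))) r).hom.toLinearMap.toAddMonoidHom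

/-- Unfolding `bidualTransport`. [cite: MilneADT2006, Ch. I §0 Prop. 0.19] -/
theorem bidualTransport_apply (hd : ∀ m : M, d • m = 0) (hn : ∀ m : M, n • m = 0) (r : ℕ)
    (c : restrictedCohomology ((ρ.tateDual n).tateDual d) S r) :
    bidualTransport S ρ n d hd hn r c =
      (ContinuousCohomology.map (ContinuousMonoidHom.id (GaloisGroupUnramifiedOutside K S))
        (ContinuousRep.invariantsHom (N := ramificationSubgroup K S)
          (TopRep.ofHom (bidualInv₂ ρ n d hd hn))) r).hom c := rfl

/-- `Hʳ(G_S, ι) : Hʳ(G_S, M^{N_S}) → Hʳ(G_S, (M^{DD})^{N_S})` for the biduality `ι = bidual` (the inverse of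
`bidualTransport`). [cite: MilneADT2006, Ch. I §0 Prop. 0.19] -/
def bidualCotransport (hd : ∀ m : M, d • m = 0) (r : ℕ) :
    restrictedCohomology ρ S r →+ restrictedCohomology ((ρ.tateDual n).tateDual d) S r :=
  (ContinuousCohomology.map (ContinuousMonoidHom.id (GaloisGroupUnramifiedOutside K S))
    (ContinuousRep.invariantsHom (N := ramificationSubgroup K S)
      (TopRep.ofHom (bidual₂ ρ n d hd))) r).hom.toLinearMap.toAddMonoidHom

omit [NumberField K] [NeZero n] [NeZero d] in
/-- Unfolding `bidualCotransport`. [cite: MilneADT2006, Ch. I §0 Prop. 0.19] -/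
theorem bidualCotransport_apply (hd : ∀ m : M, d • m = 0) (r : ℕ) (c : restrictedCohomology ρ S r) :
    bidualCotransport S ρ n d hd r c =
      (ContinuousCohomology.map (ContinuousMonoidHom.id (GaloisGroupUnramifiedOutside K S))
        (ContinuousRep.invariantsHom (N := ramificationSubgroup K S)
          (TopRep.ofHom (bidual₂ ρ n d hd))) r).hom c := rfl

/-- `κ ≫ ι = 𝟙` and `ι ≫ κ = 𝟙` as morphisms of `TopRep`. [cite: MilneADT2006, Ch. I §0 Prop. 0.19] -/
theorem ofHom_bidualInv_comp_ofHom_bidual (hd : ∀ m : M, d • m = 0) (hn : ∀ m : M, n • m = 0) :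
    (TopRep.ofHom (bidualInv₂ ρ n d hd hn) ≫ TopRep.ofHom (bidual₂ ρ n d hd) :
        ((ρ.tateDual n).tateDual d).toTopRep ⟶ ((ρ.tateDual n).tateDual d).toTopRep) = 𝟙 _ ∧
      (TopRep.ofHom (bidual₂ ρ n d hd) ≫ TopRep.ofHom (bidualInv₂ ρ n d hd hn) : ρ.toTopRep ⟶ ρ.toTopRep) = 𝟙 _ := by
  refine ⟨?_, ?_⟩
  · ext ψ : 3
    exact bidual₂_bidualInv₂ ρ n d hd hn ψ
  · ext m : 3
    exact bidualInv₂_bidual₂ ρ n d hd hn m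

/-- `Hʳ(G_S, ι) ∘ Hʳ(G_S, κ) = id`. [cite: MilneADT2006, Ch. I §0 Prop. 0.19] -/
theorem bidualCotransport_bidualTransport (hd : ∀ m : M, d • m = 0) (hn : ∀ m : M, n • m = 0) (r : ℕ)
    (c : restrictedCohomology ((ρ.tateDual n).tateDual d) S r) :
    bidualCotransport S ρ n d hd r (bidualTransport S ρ n d hd hn r c) = c := by
  have e := (invariantsHom_map_comp_apply (TopRep.ofHom (bidualInv₂ ρ n d hd hn)) (TopRep.ofHom (bidual₂ ρ n d hd))
    S r c).symm
  rw [(ofHom_bidualInv_comp_ofHom_bidual ρ n d hd hn).1, invariantsHom_map_id_apply] at e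
  exact e

/-- `Hʳ(G_S, κ) ∘ Hʳ(G_S, ι) = id`. [cite: MilneADT2006, Ch. I §0 Prop. 0.19] -/
theorem bidualTransport_bidualCotransport (hd : ∀ m : M, d • m = 0) (hn : ∀ m : M, n • m = 0) (r : ℕ)
    (c : restrictedCohomology ρ S r) :
    bidualTransport S ρ n d hd hn r (bidualCotransport S ρ n d hd r c) = c := by
  have e := (invariantsHom_map_comp_apply (TopRep.ofHom (bidual₂ ρ n d hd)) (TopRep.ofHom (bidualInv₂ ρ n d hd hn))
    S r c).symm
  rw [(ofHom_bidualInv_comp_ofHom_bidual ρ n d hd hn).2, invariantsHom_map_id_apply] at e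
  exact e

/-- **`Hʳ(G_S, κ)` is bijective** (`κ` is an isomorphism; functoriality of `Hʳ(G_S, ·^{N_S})`).
[cite: MilneADT2006, Ch. I §0 Prop. 0.19] -/
theorem bidualTransport_bijective (hd : ∀ m : M, d • m = 0) (hn : ∀ m : M, n • m = 0) (r : ℕ) :
    Bijective (bidualTransport S ρ n d hd hn r) :=
  Function.bijective_iff_has_inverse.2 ⟨bidualCotransport S ρ n d hd r,
    bidualCotransport_bidualTransport S ρ n d hd hn r, bidualTransport_bidualCotransport S ρ n d hd hn r⟩

/-! ## §3 The comparison `cmp` -/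

/-- **`cmp : Extʳ(⟨(M^D)^{N_S}⟩, ⟨Ē_S⟩) → Hʳ(G_S, M^{N_S})`** — -w7 g12's
`extAddEquivRestrictedCohomologyTateDual` at `ρ₀ := M^D(n)` (target `Hʳ(G_S, (M^{DD})^{N_S})`) followed by
`Hʳ(G_S, κ)`. [cite: Harari2020, Lemma 17.21 (a)][cite: MilneADT2006, I Lemma 4.12 and I Thm. 4.10 (a) (proof, p. 58)] -/
def cmp (hd : ∀ m : M, d • m = 0)
    (hdS : ∀ v : HeightOneSpectrum (𝓞 K), ((d : ℕ) : 𝓞 K) ∈ v.asIdeal → v ∈ S)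
    (hn : ∀ m : M, n • m = 0) (hur : ramificationSubgroup K S ≤ ContinuousRep.ker ρ) (r : ℕ) :
    Ext (ofContinuousRep (((ρ.tateDual n).quotientInvariants (ramificationSubgroup K S))))
        (ofContinuousRep (SUnits.sUnitsRestricted K S)) r →+ restrictedCohomology ρ S r :=
  (bidualTransport S ρ n d hd hn r).comp
    (RestrictedExt.extAddEquivRestrictedCohomologyTateDual K S d (ρ.tateDual n) hdS
      (nsmul_tateDual_eq_zero_of_nsmul n d hd) (ramificationSubgroup_le_ker_tateDual S ρ n d hd hdS hur) r).toAddMonoidHom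

/-- Unfolding `cmp`. [cite: Harari2020, Lemma 17.21 (a)] -/
theorem cmp_apply (hd : ∀ m : M, d • m = 0)
    (hdS : ∀ v : HeightOneSpectrum (𝓞 K), ((d : ℕ) : 𝓞 K) ∈ v.asIdeal → v ∈ S)
    (hn : ∀ m : M, n • m = 0) (hur : ramificationSubgroup K S ≤ ContinuousRep.ker ρ) (r : ℕ)
    (y : Ext (ofContinuousRep (((ρ.tateDual n).quotientInvariants (ramificationSubgroup K S))))
      (ofContinuousRep (SUnits.sUnitsRestricted K S)) r) :
    cmp S ρ n d hd hdS hn hur r y = bidualTransport S ρ n d hd hn r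
      (RestrictedExt.extAddEquivRestrictedCohomologyTateDual K S d (ρ.tateDual n) hdS
        (nsmul_tateDual_eq_zero_of_nsmul n d hd) (ramificationSubgroup_le_ker_tateDual S ρ n d hd hdS hur) r y) := rfl

/-- **`cmp` is bijective** (in particular injective: the `hcmp` of `ShaExtRoad.pairing_perfect`).
[cite: Harari2020, Lemma 17.21 (a)] -/
theorem cmp_bijective (hd : ∀ m : M, d • m = 0)
    (hdS : ∀ v : HeightOneSpectrum (𝓞 K), ((d : ℕ) : 𝓞 K) ∈ v.asIdeal → v ∈ S)
    (hn : ∀ m : M, n • m = 0) (hur : ramificationSubgroup K S ≤ ContinuousRep.ker ρ) (r : ℕ) :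
    Bijective (cmp S ρ n d hd hdS hn hur r) :=
  (bidualTransport_bijective S ρ n d hd hn r).comp
    (RestrictedExt.extAddEquivRestrictedCohomologyTateDual K S d (ρ.tateDual n) hdS
      (nsmul_tateDual_eq_zero_of_nsmul n d hd) (ramificationSubgroup_le_ker_tateDual S ρ n d hd hdS hur) r).bijective

/-! ## §4 Naturality for an adjoint pair -/

variable {M' : Type} [AddCommGroup M'] [TopologicalSpace M'] [DiscreteTopology M'] [Finite M']
  (ρ' : DiscreteGaloisModule K M') (n' d' : ℕ) [NeZero n'] [NeZero d'] [Finite (TateDual K M' n')]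

/-- **`cmp` is natural for an adjoint pair**: for `F : M → M'` and `G : M'^D(n') → M^D(n)` with
`(G φ')(m) = φ'(F m)` in `K̄ˣ`, `cmp' (G^{N_S} ∘ y) = Hʳ(G_S, F) (cmp y)` for every
`y ∈ Extʳ(⟨(M^D)^{N_S}⟩, ⟨Ē_S⟩)`.  (With `y = x ∘ [T]`: the hypothesis `hcmpG` of `ShaExtRoad.pairing_natural`.)
[cite: MilneADT2006, I Thm. 4.10 (a) and §4 p. 65][cite: Harari2020, Lemma 17.21 (a), §16.2 (16.4)] -/
theorem cmp_natural
    (hd : ∀ m : M, d • m = 0) (hdS : ∀ v : HeightOneSpectrum (𝓞 K), ((d : ℕ) : 𝓞 K) ∈ v.asIdeal → v ∈ S)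
    (hn : ∀ m : M, n • m = 0) (hur : ramificationSubgroup K S ≤ ContinuousRep.ker ρ)
    (hd' : ∀ m' : M', d' • m' = 0)
    (hdS' : ∀ v : HeightOneSpectrum (𝓞 K), ((d' : ℕ) : 𝓞 K) ∈ v.asIdeal → v ∈ S)
    (hn' : ∀ m' : M', n' • m' = 0) (hur' : ramificationSubgroup K S ≤ ContinuousRep.ker ρ')
    (F : ρ.toTopRep ⟶ ρ'.toTopRep) (G : (ρ'.tateDual n').toTopRep ⟶ (ρ.tateDual n).toTopRep)
    (hFG : ∀ (φ' : TateDual K M' n') (m : M),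
      ((Additive.toMul (G.hom φ' m) : rootsOfUnity n (AlgebraicClosure K)) : (AlgebraicClosure K)ˣ) =
        ((Additive.toMul (φ' (F.hom m)) : rootsOfUnity n' (AlgebraicClosure K)) : (AlgebraicClosure K)ˣ))
    (r : ℕ) (y : Ext (ofContinuousRep (((ρ.tateDual n).quotientInvariants (ramificationSubgroup K S))))
      (ofContinuousRep (SUnits.sUnitsRestricted K S)) r) :
    cmp S ρ' n' d' hd' hdS' hn' hur' r
        ((Ext.mk₀ (RestrictedExtTriv.quotientInvariantsMap (ρ'.tateDual n') (ρ.tateDual n) S G)).comp y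
          (zero_add r)) =
      (ContinuousCohomology.map (ContinuousMonoidHom.id (GaloisGroupUnramifiedOutside K S))
        (ContinuousRep.invariantsHom (N := ramificationSubgroup K S) F) r).hom (cmp S ρ n d hd hdS hn hur r y) := by
  -- the double transpose `F^{DD}` on the `N_S`-invariants, adjoint to `G`
  let φ : (((ρ.tateDual n).tateDual d).quotientInvariants (ramificationSubgroup K S)).toTopRep ⟶
      (((ρ'.tateDual n').tateDual d').quotientInvariants (ramificationSubgroup K S)).toTopRep :=
    ContinuousRep.invariantsHom (N := ramificationSubgroup K S)
      (TopRep.ofHom (doubleTranspose₂ ρ n d ρ' n' d' hd hn hd' F.hom))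
  have hGφ : ∀ (f : Representation.invariants
        (((ρ.tateDual n).tateDual d).toRepresentation.comp (ramificationSubgroup K S).subtype))
      (m' : Representation.invariants ((ρ'.tateDual n').toRepresentation.comp (ramificationSubgroup K S).subtype)),
      kummerInclAddHom K d'
          ((show TateDual K M' n' →+ MuCarrier K d' from
              ((φ.hom f : Representation.invariants
                  (((ρ'.tateDual n').tateDual d').toRepresentation.comp (ramificationSubgroup K S).subtype)) :
                TateDual K (TateDual K M' n') d'))
            (m' : TateDual K M' n')) =
        kummerInclAddHom K d
          ((show TateDual K M n →+ MuCarrier K d from (f : TateDual K (TateDual K M n) d))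
            (((RestrictedExtTriv.quotientInvariantsMap (ρ'.tateDual n') (ρ.tateDual n) S G).hom.hom m' :
                Representation.invariants ((ρ.tateDual n).toRepresentation.comp (ramificationSubgroup K S).subtype)) :
              TateDual K M n)) := by
    intro f m'
    change kummerInclAddHom K d' (doubleTranspose₂ ρ n d ρ' n' d' hd hn hd' F.hom
        (f : TateDual K (TateDual K M n) d) (m' : TateDual K M' n')) =
      kummerInclAddHom K d ((f : TateDual K (TateDual K M n) d) (G.hom (m' : TateDual K M' n')))
    exact congrArg UnitsCarrier.ofUnits
      (muVal_doubleTranspose₂_apply ρ n d ρ' n' d' hd hn hd' F.hom (fun φ' => G.hom φ') hFG f.1 m'.1)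
  -- -w7 g12's naturality of the comparison for `(G^{N_S}, φ)`
  have hw := RestrictedExt.extAddEquivRestrictedCohomologyTateDual_precomp K S d d' (ρ.tateDual n)
    (ρ'.tateDual n') hdS (nsmul_tateDual_eq_zero_of_nsmul n d hd)
    (ramificationSubgroup_le_ker_tateDual S ρ n d hd hdS hur)
    hdS' (nsmul_tateDual_eq_zero_of_nsmul n' d' hd') (ramificationSubgroup_le_ker_tateDual S ρ' n' d' hd' hdS' hur')
    (RestrictedExtTriv.quotientInvariantsMap (ρ'.tateDual n') (ρ.tateDual n) S G) φ hGφ r y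
  -- the square `κ' ∘ F^{DD} = F ∘ κ`
  have hsq : (TopRep.ofHom (doubleTranspose₂ ρ n d ρ' n' d' hd hn hd' F.hom) ≫
      TopRep.ofHom (bidualInv₂ ρ' n' d' hd' hn') :
      ((ρ.tateDual n).tateDual d).toTopRep ⟶ ρ'.toTopRep) = TopRep.ofHom (bidualInv₂ ρ n d hd hn) ≫ F := by
    ext ψ
    exact bidualInv₂_doubleTranspose₂ ρ n d ρ' n' d' hd hn hd' hn' F.hom ψ
  have hw' : (ContinuousCohomology.map (ContinuousMonoidHom.id (GaloisGroupUnramifiedOutside K S))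
      (ContinuousRep.invariantsHom (N := ramificationSubgroup K S)
        (TopRep.ofHom (doubleTranspose₂ ρ n d ρ' n' d' hd hn hd' F.hom))) r).hom
      (RestrictedExt.extAddEquivRestrictedCohomologyTateDual K S d (ρ.tateDual n) hdS
        (nsmul_tateDual_eq_zero_of_nsmul n d hd) (ramificationSubgroup_le_ker_tateDual S ρ n d hd hdS hur) r y) =
      RestrictedExt.extAddEquivRestrictedCohomologyTateDual K S d' (ρ'.tateDual n') hdS'
        (nsmul_tateDual_eq_zero_of_nsmul n' d' hd') (ramificationSubgroup_le_ker_tateDual S ρ' n' d' hd' hdS' hur') r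
        ((Ext.mk₀ (RestrictedExtTriv.quotientInvariantsMap (ρ'.tateDual n') (ρ.tateDual n) S G)).comp y
          (zero_add r)) := hw
  rw [cmp_apply, cmp_apply, bidualTransport_apply, bidualTransport_apply, ← hw']
  -- `Hʳ(κ') ∘ Hʳ(F^{DD}) = Hʳ(F^{DD} ≫ κ') = Hʳ(κ ≫ F) = Hʳ(F) ∘ Hʳ(κ)` (N0 functoriality)
  have e := (invariantsHom_map_comp_apply (TopRep.ofHom (doubleTranspose₂ ρ n d ρ' n' d' hd hn hd' F.hom))
    (TopRep.ofHom (bidualInv₂ ρ' n' d' hd' hn')) S r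
    (RestrictedExt.extAddEquivRestrictedCohomologyTateDual K S d (ρ.tateDual n) hdS
      (nsmul_tateDual_eq_zero_of_nsmul n d hd) (ramificationSubgroup_le_ker_tateDual S ρ n d hd hdS hur) r y)).symm
  rw [hsq, invariantsHom_map_comp_apply] at e
  exact e

end RestrictedExtCmp

end Literature.NumberTheory.GaloisCohomology

end
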